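import Summits.ABC.ABC.Theorems.DefiniteXiDefiniteRTControlPrimeOfTakahashi
import Literature.NumberTheory.EllipticCurves.TakahashiDegreeFormulaCoprimeProofs
import HarnessLib

/-!
# STUB-IDEAS companion — `stub_takahashi` · ideator k1 · generation 22 (FAMILY 1: recognise & import)

Crux `stmt-ABC-11338` (`Summit.ABC.ABC.Theses.DefiniteXi.DefiniteRTControlPrime`); registered stub
`theorem stub_takahashi : takahashi2001_thm_2_3_of_coprime` (the reviewed, cite-tagged NAMED FACT
`Literature.NumberTheory.EllipticCurves.takahashi2001_thm_2_3_of_coprime`, `TakahashiDegreeFormula.lean:265`).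

Purpose of this file: HEAD sanity of every declaration the gen-22 sheet
`STUB-IDEAS-stub_takahashi-1.md` cites as a helper/door (no new mathematics; no `sorry`):

* `stub_of_fact` — Plan A door (inside a skeleton the stub closes only by the fact itself);
* `crux_of_stub` — the ONE-stub composition BY NAME over the landed part 7/7
  `Summit.ABC.ABC.Theorems.DefiniteRTControlPrime.definiteRTControlPrime_of_takahashi`
  (`Theorems/DefiniteXiDefiniteRTControlPrimeOfTakahashi.lean:279`);
* the import doors `takahashi2001_thm_2_3_of_coprime_of_exists_setup` (one Brandt setup per `(M, r)`
  suffices) and `takahashi2001_thm_2_3_of_coprime_of_brandtDictionary_one'` (rank one + geometric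
  Brandt dictionary ⇒ fact) resolve;
* `padic_shadow` — the `p`-adic one-sided shadow of the stub that the patching literature speaks
  (Böckle–Khare–Manning, JIMJ 2024 = arXiv:2108.09729, Thm. 7.4, the `≤` line, one Steinberg prime,
  definite side): `v_p δ ≤ v_p ξ_S + v_p c_r`, a two-line consequence of the tree's
  `takahashi2001_thm_2_3_of_coprime.modularDegree_dvd_xi_mul` (`δ ∣ ξ_S · c_r`).  It is recorded
  only as the DICTIONARY LINE between the stub and [BKM2]/[PW11]; it does not point back at the stub.
-/

set_option linter.dupNamespace false

namespace Summit.ABC.ABC.Cruxes.DefiniteRTControlPrime.StubIdeas1G22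

open Literature.NumberTheory.EllipticCurves Literature.NumberTheory.EllipticCurves.ModularForms
open Literature.NumberTheory.Automorphic

/-- L0 (Plan A door): the stub's type IS the fact constant; `exact h` is the whole proof available
inside any skeleton. [cite: Takahashi2001, Thm. 2.3 (p. 79)] -/
theorem stub_of_fact (h : takahashi2001_thm_2_3_of_coprime) : takahashi2001_thm_2_3_of_coprime := h

/-- L1: the crux BY NAME from the stub alone — the 1-stub line's composition term, elaborating at
HEAD against the landed `definiteRTControlPrime_of_takahashi`. -/
theorem crux_of_stub (h : takahashi2001_thm_2_3_of_coprime) :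
    Summit.ABC.ABC.Theses.DefiniteXi.DefiniteRTControlPrime :=
  Summit.ABC.ABC.Theorems.DefiniteRTControlPrime.definiteRTControlPrime_of_takahashi h

/-- L2 door resolves (one setup per `(M, r)` suffices, `Brandt.XiSetup.xi_eq_xi`). -/
example := @takahashi2001_thm_2_3_of_coprime_of_exists_setup

/-- L3 door resolves (rank-one Brandt eigenlattice + character-group dictionary ⇒ fact). -/
example := @takahashi2001_thm_2_3_of_coprime_of_brandtDictionary_one'

/-- L5 (`p`-adic shadow = the `≤` line of [BKM2, Thm. 7.4] at one Steinberg prime on the definite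
side, in the tree's coordinates): `v_p(δ) ≤ v_p(ξ_S) + v_p(ord_r Δ_min)` for the optimal datum,
whenever the right-hand product is nonzero.  From `modularDegree_dvd_xi_mul`. -/
theorem padic_shadow (h : takahashi2001_thm_2_3_of_coprime) (W : WeierstrassCurve ℚ)
    [W.IsElliptic] (M r : ℕ) [NeZero (M * r)] (hr : r.Prime) (hcop : M.Coprime r)
    (hN : W.conductorNorm ℤ = M * r) (P : ModularParametrizationData W (M * r))
    (hmin : ∀ (W' : WeierstrassCurve ℚ) [W'.IsElliptic], W'.conductorNorm ℤ = M * r →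
      ∀ P' : ModularParametrizationData W' (M * r),
        P'.f = P.f → P.modularDegree ≤ P'.modularDegree) (S : Brandt.XiSetup M r)
    (h0 : S.xi (fun n => W.LFunction n) * (W.minimalDiscriminantNorm ℤ).factorization r ≠ 0)
    (p : ℕ) [hp : Fact p.Prime] :
    padicValNat p P.modularDegree ≤
      padicValNat p (S.xi (fun n => W.LFunction n)) +
        padicValNat p ((W.minimalDiscriminantNorm ℤ).factorization r) := by
  have hdvd :=
    takahashi2001_thm_2_3_of_coprime.modularDegree_dvd_xi_mul h W M r hr hcop hN P hmin S
  have hx : S.xi (fun n => W.LFunction n) ≠ 0 := left_ne_zero_of_mul h0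
  have hc : (W.minimalDiscriminantNorm ℤ).factorization r ≠ 0 := right_ne_zero_of_mul h0
  have hδ0 : P.modularDegree ≠ 0 := by
    rintro hδ
    rw [hδ, zero_dvd_iff] at hdvd
    exact h0 hdvd
  have key := (Nat.factorization_le_iff_dvd hδ0 h0).mpr hdvd p
  rw [Nat.factorization_mul hx hc, Finsupp.add_apply] at key
  simpa only [Nat.factorization_def _ hp.out] using key

end Summit.ABC.ABC.Cruxes.DefiniteRTControlPrime.StubIdeas1G22
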